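/-
Copyright (c) 2026 the pub-hodgecm-mathlib formalisation cell (harness21).  Prover seat hodgecm-mathlib-K2E1-p11 (g2), Track B ∕ K2-LIT, h413 =
`stmt-HodgeConjecture-24833`, line `K2_E1_TraceFormulaBeta`, 5Res campaign «ENDGAME BY FAMILIES» ∕ ROADCARD §3′ (M2 v2), deal (255)(y2): the ALL-OF-`H` upgrade of ★ FILE B2
`hU_offDual_cm_two` — `U (R(η) v) = σ • U v` for EVERY `v ∈ L²(X)`, `U = U_iso ∘ P_Θ` the global model map of ★ p860498, once `R(η)†(Θ) ⊆ Θ` (letter `hadjΘ`, paid by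
`R(η)† = R(η*)` ★ + ★ FILE B2 on `η*`).
-/
import Summits.HodgeConjecture.HodgeConjecture.Theorems.K2E1ChiSectionHeckeIntertwiningCMTwo    -- ★ (x1) FILE B2 p860634 (this seat): `hU_offDual_cm_two`; brings ★ FILE B1∕A, ★ P3a
import Summits.HodgeConjecture.HodgeConjecture.Theorems.K2E1SymbolActionThroughModelMap          -- ★ D4′b-2 (K2E4-p23): `map_mem_orthogonal_of_adjoint`; brings ★ p860498 modelMap (`modelMap_apply_of_mem`, `…_eq_zero_of_mem_orthogonal`, `completeSpace_topologicalClosure_span`)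
import HarnessLib

/-!
# (y2) — `K2E1ChiSectionHeckeIntertwiningGlobalCMTwo`: `U (R(η) v) = σ • U v` on ALL of `L²(X)` for the global model map `U = U_iso ∘ P_Θ` (off-dual blocks)

Cell `pub/hodgecm-mathlib`, crux H413 = `stmt-HodgeConjecture-24833`, route `HCCMUnconditional`; dealer K2E1-plan (g7) deal (255)(y2) («the 15-line ALL-OF-H upgrade … so K2E4-p23's `hU` binder is
met byte-for-byte with `U :=` ★ p860498 modelMap; no Gram letter needed on your route»).  THEOREMS ONLY (no `def` ∕ `instance` ∕ `notation` ∕ named-fact hypothesis ∕ `sorry`); lane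
`--kind proof --supports stmt-HodgeConjecture-24833 --as helper` (count-neutral; closes no socket).
THE MATHEMATICS ([ReedSimonI1980, Thm. II.3]; [MoeglinWaldspurger1995, II.2.4, VI.2]).  (§1, abstract) Let `Θ = closure span x ≤ H`, `U_iso : Θ →ₗᵢ M`, `U = U_iso ∘ P_Θ`.  If a bounded `T` maps
`Θ` into `Θ`, its adjoint does too (`hTadjΘ`), and ON `Θ` one has `U_iso(T v) = S(U_iso v)` for a bounded `S` (the DIRECT generator route of ★ FILE B2 §0 — NO Gram letter), then
**`U(T v) = S(U v)` for every `v ∈ H`**: split `v = P_Θ v + (v − P_Θ v)`, `T(Θᗮ) ⊆ Θᗮ` (★ `map_mem_orthogonal_of_adjoint`), `U(Θᗮ) = 0`.  (§2, `U(1,1)_{L∕L⁺}`, off-dual blocks) With the data of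
★ `hU_offDual_cm_two` and the letter `hadjΘ : R(η)†(Θ) ⊆ Θ` (payer: `R(η)† = R(η*)` ★ `adjoint_integratedOperator`, `η*` again a `K_∞`-central pure tensor, so ★ FILE B2's
`apply_mem_topologicalClosure_span_of_generators` on the `η*`-generator relation): **`U(R(η) v) = σ • U v` for ALL `v`**, `σ = s(½+i·) ∈ L^∞(ℝ × K_U)` — K2E4-p23's `hU` binder with
`U :=` the global model map.
* §1 **`modelMap_map_eq_of_on_closedSpan`**, **`modelMap_map_eq_lpSMul_of_on_closedSpan`** (the `L^∞`-multiplier edition in ★ FILE B2's output shape).  * §2 **`hU_offDual_global_cm_two`**.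
HONEST LABEL.  Count-neutral helper; proves no printed statement; letter-free except ★ P1's `hact`, K2E4-p10's isometry data, the τ-closure representatives, and `hadjΘ`.  HC_CM is proved
only modulo the 7 printed citations (2 remaining named inputs: hLiu418 = `stmt-HodgeConjecture-24832`, h413 = `stmt-HodgeConjecture-24833`) until rung 0 closes.

## References
* [ReedSimonI1980] M. Reed, B. Simon, *Methods of Modern Mathematical Physics I* (1980), Thm. II.3 (projection theorem), Thm. I.7.
* [MoeglinWaldspurger1995] C. Mœglin, J.-L. Waldspurger, *Spectral decomposition and Eisenstein series* (1995), II.2.4, VI.2.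
-/

set_option autoImplicit false
-- the mandated namespace repeats `HodgeConjecture.HodgeConjecture`, as in every `Theorems/*.lean` of this sub-problem
set_option linter.dupNamespace false

noncomputable section

open MeasureTheory MeasureTheory.Measure Set Filter Topology Complex NumberField CompactlySupported Submodule
open scoped NNReal ENNReal
open Literature.NumberTheory.Automorphic Literature.NumberTheory.Automorphic.UnitaryGroup AdelicGroupData ContRepresentation
open Literature.NumberTheory.GaloisRepresentations (HeckeCharacter)
open Summit.HodgeConjecture.HodgeConjecture.Cruxes.H413.K2E1BorelEisensteinU
open Summit.HodgeConjecture.HodgeConjecture.Cruxes.H413.K2E1CharacterEisensteinU2Defs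
open Summit.HodgeConjecture.HodgeConjecture.Cruxes.H413.K2E1PlancherelIsometryOfForm (mem_topologicalClosure_span)
open Summit.HodgeConjecture.HodgeConjecture.Cruxes.H413.K2E1PlancherelModelMapOfIsometry (completeSpace_topologicalClosure_span modelMap_apply_of_mem modelMap_apply_eq_zero_of_mem_orthogonal)
open Summit.HodgeConjecture.HodgeConjecture.Cruxes.H413.K2E1SymbolActionThroughModelMap (map_mem_orthogonal_of_adjoint)
open Summit.HodgeConjecture.HodgeConjecture.Cruxes.H413.K2E1ChiSectionHeckeIntertwiningCMTwo (hU_offDual_cm_two)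

namespace Summit.HodgeConjecture.HodgeConjecture.Cruxes.H413.K2E1ChiSectionHeckeIntertwiningGlobalCMTwo

/-! ## §1 From the closed span to all of `H` through the global model map -/

section Abstract

variable {ι H M : Type*} [NormedAddCommGroup H] [InnerProductSpace ℂ H] [CompleteSpace H] [NormedAddCommGroup M] [InnerProductSpace ℂ M]

/-- **`U(Tv) = S(Uv)` ON ALL OF `H`** for the global model map `U = U_iso ∘ P_Θ`: if `T(Θ) ⊆ Θ`, `T†(Θ) ⊆ Θ` and `U_iso(Tv) = S(U_iso v)` on `Θ` (the direct generator route of ★ FILE B2),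
then the identity holds for every `v` (`T(Θᗮ) ⊆ Θᗮ` ★ `map_mem_orthogonal_of_adjoint`; `U(Θᗮ) = 0` ★ `modelMap_apply_eq_zero_of_mem_orthogonal`). [cite: ReedSimonI1980, Thm. II.3] -/
theorem modelMap_map_eq_of_on_closedSpan (x : ι → H) (Uiso : ↥(span ℂ (Set.range x)).topologicalClosure →ₗᵢ[ℂ] M)
    (T : H →L[ℂ] H) (S : M →L[ℂ] M)
    (hTΘ : ∀ v ∈ (span ℂ (Set.range x)).topologicalClosure, T v ∈ (span ℂ (Set.range x)).topologicalClosure)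
    (hTadjΘ : ∀ v ∈ (span ℂ (Set.range x)).topologicalClosure, ContinuousLinearMap.adjoint T v ∈ (span ℂ (Set.range x)).topologicalClosure)
    (hon : ∀ (v : H) (hv : v ∈ (span ℂ (Set.range x)).topologicalClosure), Uiso ⟨T v, hTΘ v hv⟩ = S (Uiso ⟨v, hv⟩)) (v : H) :
    haveI := completeSpace_topologicalClosure_span x
    (Uiso.toContinuousLinearMap.comp (span ℂ (Set.range x)).topologicalClosure.orthogonalProjectionOnto) (T v) =
      S ((Uiso.toContinuousLinearMap.comp (span ℂ (Set.range x)).topologicalClosure.orthogonalProjectionOnto) v) := by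
  haveI := completeSpace_topologicalClosure_span x
  set p : ↥(span ℂ (Set.range x)).topologicalClosure := (span ℂ (Set.range x)).topologicalClosure.orthogonalProjectionOnto v with hp
  have hperp : v - (p : H) ∈ ((span ℂ (Set.range x)).topologicalClosure)ᗮ := by
    rw [hp, ← Submodule.starProjection_apply]
    exact Submodule.sub_starProjection_mem_orthogonal v
  have hsplit : T v = T (p : H) + T (v - (p : H)) := by rw [← map_add, add_sub_cancel]
  have hTperp : T (v - (p : H)) ∈ ((span ℂ (Set.range x)).topologicalClosure)ᗮ := map_mem_orthogonal_of_adjoint _ T hTadjΘ hperp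
  have hzero := modelMap_apply_eq_zero_of_mem_orthogonal x Uiso hTperp
  have honp : (Uiso.toContinuousLinearMap.comp (span ℂ (Set.range x)).topologicalClosure.orthogonalProjectionOnto) (T (p : H)) = S (Uiso p) := by
    rw [modelMap_apply_of_mem x Uiso ⟨T (p : H), hTΘ _ p.2⟩]
    exact hon (p : H) p.2
  have hv : (Uiso.toContinuousLinearMap.comp (span ℂ (Set.range x)).topologicalClosure.orthogonalProjectionOnto) v = Uiso p := rfl
  rw [hv, hsplit, map_add, honp, hzero, add_zero]

/-- **THE `L^∞`-MULTIPLIER EDITION**: with `M = L²(m)` and `S = σ • ·` (`σ ∈ L^∞`, Hölder `∞·2 → 2`), the closed-span statement in the shape of ★ FILE B2's head —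
`∀ v ∈ Θ, ∃ hTv : T v ∈ Θ, U_iso ⟨T v, hTv⟩ = σ • U_iso ⟨v, hv⟩` — upgrades to **`U(Tv) = σ • U v` for every `v ∈ H`** once `T†(Θ) ⊆ Θ`. [cite: ReedSimonI1980, Thm. II.3] -/
theorem modelMap_map_eq_lpSMul_of_on_closedSpan {X : Type*} [MeasurableSpace X] {m : MeasureTheory.Measure X} [ENNReal.HolderTriple ∞ 2 2]
    (x : ι → H) (Uiso : ↥(span ℂ (Set.range x)).topologicalClosure →ₗᵢ[ℂ] Lp ℂ 2 m) (T : H →L[ℂ] H) {σ : X → ℂ} (hσ : MemLp σ ∞ m)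
    (hon : ∀ (v : H) (hv : v ∈ (span ℂ (Set.range x)).topologicalClosure),
      ∃ hTv : T v ∈ (span ℂ (Set.range x)).topologicalClosure, Uiso ⟨T v, hTv⟩ = (hσ.toLp σ : Lp ℂ ∞ m) • Uiso ⟨v, hv⟩)
    (hTadjΘ : ∀ v ∈ (span ℂ (Set.range x)).topologicalClosure, ContinuousLinearMap.adjoint T v ∈ (span ℂ (Set.range x)).topologicalClosure) (v : H) :
    haveI := completeSpace_topologicalClosure_span x
    (Uiso.toContinuousLinearMap.comp (span ℂ (Set.range x)).topologicalClosure.orthogonalProjectionOnto) (T v) =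
      (hσ.toLp σ : Lp ℂ ∞ m) • (Uiso.toContinuousLinearMap.comp (span ℂ (Set.range x)).topologicalClosure.orthogonalProjectionOnto) v := by
  -- the multiplier as an opaque bounded map
  have hMex : ∃ Mop : Lp ℂ 2 m →L[ℂ] Lp ℂ 2 m, ∀ g, Mop g = (hσ.toLp σ : Lp ℂ ∞ m) • g :=
    ⟨LinearMap.mkContinuous
      { toFun := fun g => (hσ.toLp σ : Lp ℂ ∞ m) • g
        map_add' := fun g₁ g₂ => MeasureTheory.Lp.add_smul _ g₁ g₂
        map_smul' := fun a g => (MeasureTheory.Lp.smul_comm a _ g).symm }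
      ‖(hσ.toLp σ : Lp ℂ ∞ m)‖ (fun g => MeasureTheory.Lp.norm_smul_le _ g), fun g => rfl⟩
  obtain ⟨Mop, hMop⟩ := hMex
  have hTΘ : ∀ v ∈ (span ℂ (Set.range x)).topologicalClosure, T v ∈ (span ℂ (Set.range x)).topologicalClosure := fun v hv => (hon v hv).1
  have hon' : ∀ (v : H) (hv : v ∈ (span ℂ (Set.range x)).topologicalClosure), Uiso ⟨T v, hTΘ v hv⟩ = Mop (Uiso ⟨v, hv⟩) := fun v hv => by
    rw [hMop]
    exact (hon v hv).2
  rw [← hMop]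
  exact modelMap_map_eq_of_on_closedSpan x Uiso T Mop hTΘ hTadjΘ hon' v

end Abstract

/-! ## §2 `U(R(η)v) = σ • U v` on all of `L²(X)` (off-dual blocks of `U(1,1)_{L∕L⁺}`) -/

section Two

variable (L : Type) [Field L] [NumberField L] [IsCMField L]
variable [MeasurableSpace (quasiSplit (↥(maximalRealSubfield L)) L (IsCMField.complexConj L) 2).Adelic] [BorelSpace (quasiSplit (↥(maximalRealSubfield L)) L (IsCMField.complexConj L) 2).Adelic]

/-- **`hU` WITH THE GLOBAL MODEL MAP — `U(R(η)v) = σ • U v` FOR EVERY `v ∈ L²(X)`** (off-dual `(χ,K′,ω)`-blocks of `U(1,1)_{L∕L⁺}`): the data of ★ `hU_offDual_cm_two` plus the letter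
`hadjΘ : R(η)†(Θ) ⊆ Θ`; `U := U_iso ∘ P_Θ` (★ p860498).  §1 with `T := R(η)`, `S := σ • ·`. [cite: MoeglinWaldspurger1995, II.2.4, VI.2] [cite: ReedSimonI1980, Thm. II.3] -/
theorem hU_offDual_global_cm_two [ENNReal.HolderTriple ∞ 2 2]
    [LocallyCompactSpace (quasiSplit (↥(maximalRealSubfield L)) L (IsCMField.complexConj L) 2).Adelic] [SecondCountableTopology (quasiSplit (↥(maximalRealSubfield L)) L (IsCMField.complexConj L) 2).Adelic]
    (μ : Measure (quasiSplit (↥(maximalRealSubfield L)) L (IsCMField.complexConj L) 2).automorphicQuotient) [(quasiSplit (↥(maximalRealSubfield L)) L (IsCMField.complexConj L) 2).IsAutomorphicMeasure μ]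
    (νG : Measure (quasiSplit (↥(maximalRealSubfield L)) L (IsCMField.complexConj L) 2).Adelic) [νG.IsHaarMeasure] [SFinite νG]
    (μK : Measure ((standardMaximalCompactGL 2 L).comap (adelicVal (↥(maximalRealSubfield L)) L (IsCMField.complexConj L) 2 ((StdForm.antidiagonal 2).over L)) : Subgroup (quasiSplit (↥(maximalRealSubfield L)) L (IsCMField.complexConj L) 2).Adelic))
    [IsFiniteMeasure μK]
    (η : C_c((quasiSplit (↥(maximalRealSubfield L)) L (IsCMField.complexConj L) 2).Adelic, ℂ)) {χ : HeckeCharacter L}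
    {ι : Type*} [Nonempty ι] {f : ι → ℝ → ℂ} {φ : ι → (quasiSplit (↥(maximalRealSubfield L)) L (IsCMField.complexConj L) 2).Adelic → ℂ}
    (hφ : ∀ i, IsChiSection χ (φ i)) (hφc : ∀ i, Continuous (φ i)) (Mφ : ι → ℝ) (hφM : ∀ i x, ‖φ i x‖ ≤ Mφ i)
    (k₀ : ι → (quasiSplit (↥(maximalRealSubfield L)) L (IsCMField.complexConj L) 2).Adelic) (hk₀ : ∀ i, adelicVal (↥(maximalRealSubfield L)) L (IsCMField.complexConj L) 2 ((StdForm.antidiagonal 2).over L) (k₀ i) ∈ standardMaximalCompactGL 2 L)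
    (hx₀ : ∀ i, φ i (k₀ i) ≠ 0)
    (hf : ∀ i, ContDiff ℝ 2 (f i)) (hfs : ∀ i, HasCompactSupport (f i)) (hf0 : ∀ i, tsupport (f i) ⊆ Ioi 0)
    {s : ℂ → ℂ} (hsc : Continuous s)
    (hact : ∀ (i : ι) (z : ℂ) (x : (quasiSplit (↥(maximalRealSubfield L)) L (IsCMField.complexConj L) 2).Adelic), ∫ y, η y * flatSectionU (φ i) z (x * y) ∂νG = s z * flatSectionU (φ i) z x)
    (x : ι → Lp ℂ 2 μ)
    (hx : ∀ i, (x i : (quasiSplit (↥(maximalRealSubfield L)) L (IsCMField.complexConj L) 2).automorphicQuotient → ℂ) =ᵐ[μ]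
      (quasiSplit (↥(maximalRealSubfield L)) L (IsCMField.complexConj L) 2).quotFun (eisensteinSeriesU (fun g : (quasiSplit (↥(maximalRealSubfield L)) L (IsCMField.complexConj L) 2).Adelic => f i (borelHeight g : ℝ) * φ i g)))
    (u : ι → Lp ℂ 2 ((volume : Measure ℝ).prod μK))
    (hu : ∀ i, (u i : ℝ × ((standardMaximalCompactGL 2 L).comap (adelicVal (↥(maximalRealSubfield L)) L (IsCMField.complexConj L) 2 ((StdForm.antidiagonal 2).over L)) : Subgroup (quasiSplit (↥(maximalRealSubfield L)) L (IsCMField.complexConj L) 2).Adelic) → ℂ)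
      =ᵐ[(volume : Measure ℝ).prod μK] fun p => mellin (f i) (-((((1 / 2 : ℝ)) : ℂ) + p.1 * I)) * φ i (p.2 : (quasiSplit (↥(maximalRealSubfield L)) L (IsCMField.complexConj L) 2).Adelic))
    (τ : ι → ι)
    (hxτ : ∀ i, (x (τ i) : (quasiSplit (↥(maximalRealSubfield L)) L (IsCMField.complexConj L) 2).automorphicQuotient → ℂ) =ᵐ[μ]
      (quasiSplit (↥(maximalRealSubfield L)) L (IsCMField.complexConj L) 2).quotFun (eisensteinSeriesU (fun g : (quasiSplit (↥(maximalRealSubfield L)) L (IsCMField.complexConj L) 2).Adelic =>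
        (fun r : ℝ => ∫ w, f i (r * (borelHeight w : ℝ)) * (η ((k₀ i)⁻¹ * w) * (φ i w / φ i (k₀ i))) ∂νG) (borelHeight g : ℝ) * φ i g)))
    (huτ : ∀ i, (u (τ i) : ℝ × ((standardMaximalCompactGL 2 L).comap (adelicVal (↥(maximalRealSubfield L)) L (IsCMField.complexConj L) 2 ((StdForm.antidiagonal 2).over L)) : Subgroup (quasiSplit (↥(maximalRealSubfield L)) L (IsCMField.complexConj L) 2).Adelic) → ℂ)
      =ᵐ[(volume : Measure ℝ).prod μK] fun p =>
        mellin (fun r : ℝ => ∫ w, f i (r * (borelHeight w : ℝ)) * (η ((k₀ i)⁻¹ * w) * (φ i w / φ i (k₀ i))) ∂νG) (-((((1 / 2 : ℝ)) : ℂ) + p.1 * I)) * φ i (p.2 : (quasiSplit (↥(maximalRealSubfield L)) L (IsCMField.complexConj L) 2).Adelic))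
    {cU : ℂ} (U : (span ℂ (Set.range x)).topologicalClosure →ₗᵢ[ℂ] Lp ℂ 2 ((volume : Measure ℝ).prod μK))
    (hU : ∀ i, U ⟨x i, mem_topologicalClosure_span x i⟩ = cU • u i)
    (hadjΘ : ∀ v ∈ (span ℂ (Set.range x)).topologicalClosure,
      ContinuousLinearMap.adjoint (((quasiSplit (↥(maximalRealSubfield L)) L (IsCMField.complexConj L) 2).rightRegular μ).integratedOperator ((quasiSplit (↥(maximalRealSubfield L)) L (IsCMField.complexConj L) 2).isUnitary_rightRegular μ) ((quasiSplit (↥(maximalRealSubfield L)) L (IsCMField.complexConj L) 2).isStronglyContinuous_rightRegular_holds μ) νG η) v ∈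
        (span ℂ (Set.range x)).topologicalClosure) :
    ∃ hw : MemLp (fun p : ℝ × ((standardMaximalCompactGL 2 L).comap (adelicVal (↥(maximalRealSubfield L)) L (IsCMField.complexConj L) 2 ((StdForm.antidiagonal 2).over L)) : Subgroup (quasiSplit (↥(maximalRealSubfield L)) L (IsCMField.complexConj L) 2).Adelic) =>
        s ((((1 / 2 : ℝ)) : ℂ) + p.1 * I)) ∞ ((volume : Measure ℝ).prod μK),
      ∀ v : Lp ℂ 2 μ,
        haveI := completeSpace_topologicalClosure_span x
        (U.toContinuousLinearMap.comp (span ℂ (Set.range x)).topologicalClosure.orthogonalProjectionOnto)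
            ((((quasiSplit (↥(maximalRealSubfield L)) L (IsCMField.complexConj L) 2).rightRegular μ).integratedOperator ((quasiSplit (↥(maximalRealSubfield L)) L (IsCMField.complexConj L) 2).isUnitary_rightRegular μ) ((quasiSplit (↥(maximalRealSubfield L)) L (IsCMField.complexConj L) 2).isStronglyContinuous_rightRegular_holds μ) νG η) v) =
          (hw.toLp _ : Lp ℂ ∞ ((volume : Measure ℝ).prod μK)) •
            (U.toContinuousLinearMap.comp (span ℂ (Set.range x)).topologicalClosure.orthogonalProjectionOnto) v := by
  obtain ⟨hw, hB2⟩ := hU_offDual_cm_two L μ νG μK η hφ hφc Mφ hφM k₀ hk₀ hx₀ hf hfs hf0 hsc hact x hx u hu τ hxτ huτ U hU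
  exact ⟨hw, fun v => modelMap_map_eq_lpSMul_of_on_closedSpan x U _ hw hB2 hadjΘ v⟩

end Two

end Summit.HodgeConjecture.HodgeConjecture.Cruxes.H413.K2E1ChiSectionHeckeIntertwiningGlobalCMTwo

end
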